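import Summits.HodgeConjecture.Ring2.LowDimensionHodgeOfMarkman
import Literature.AlgebraicGeometry.HodgeTheory.CodimTwoDivisorPullbackGenerated
import Literature.AlgebraicGeometry.Pohlmann1968.SimpleCMAbelianVarietyPowersDivisorGenerated
import HarnessLib

/-!
# Ring 2 (cell topic `Summits/HodgeConjecture/Ring2/`; seat `lit`, gen 64, programme R38): MOONEN–ZARHIN Thm. 0.2 IN CODIMENSION 2 — `B²(X) ⊆ D²(X) + Σ_α α^* B²(X')` — FOR EVERY NON-SIMPLE COMPLEX ABELIAN FIVEFOLD OUTSIDE CASE (e) AND THE RESIDUAL OF CASE (g), UNCONDITIONALLY; the named fact `MoonenZarhin1999_codimTwoHodgeClasses_abelianFivefold` localised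

HONEST FRAMING (cell `pub-hodge-ring2`, verbatim): research route conditional on HC_CM; not a corollary;
Q11.4-sentence-2 already refuted in dim ≥ 3. `HC_CM` does NOT occur in this file, nor does Markman's theorem; the
Tankeev–Ribet fact occurs only as the HYPOTHESIS of the last theorem. NEW as an assembly (hence under `Summits/`);
theorems only — no definition, no named fact, no `sorry`.

THE PRINT. B. Moonen, Yu. Zarhin, *Hodge classes on abelian varieties of low dimension*, Math. Ann. **315** (1999)
711–733, Thm. 0.2 with (2.8), §5 (5.11) — the tree's NAMED FACT `MoonenZarhin1999_codimTwoHodgeClasses_abelianFivefold`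
(`Literature/AlgebraicGeometry/HodgeTheory/AbelianLowDimensionCodimTwoHodgeClasses`): for every complex abelian
fivefold, every rational `(2,2)`-class lies in `D² ⊗ ℂ ⊔ span_ℂ {α^* w : α a surjective homomorphism onto an abelian
fourfold, w a rational (2,2)-class}`; its pointwise form is the Literature predicate `IsCodimTwoDivisorPullbackGenerated X`
(`HodgeTheory/CodimTwoDivisorPullbackGenerated`, lit gen 64: `fact ↔ ∀ X, dim X = 5 → IsCodimTwoDivisorPullbackGenerated X`,
`Iff.rfl`), which that file proves for `Y × C` with product span (the Künneth row), for case (f), and for a simple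
fourfold times an elliptic curve outside the residual of case (g).

THIS FILE assembles the census over all fivefolds from the cell's shape lemmas (`Ring2/LowDimensionHodgeOfMarkman` §1:
an isogeny factor has a complement; `E, T ≼ X⁵ ⟹ X ∼ C × (E × T)`) and the cell's UNCONDITIONAL Thm. 0.2 (4)
(`NonSimpleFivefolds.isStablyNondegenerate_of_dim_eq_five_of_not_isSimple`: no simple fourfold factor, outside (e)/(f)
⟹ `B•(Xⁿ) = D•(Xⁿ)`):

* §1 `isCodimTwoDivisorPullbackGenerated_of_avDominatedBy_simpleFourfold` — a fivefold with a SIMPLE FOURFOLD isogeny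
  factor `F` (then `X ∼ F × C`) satisfies the predicate unless `(F, C)` is in the residual of case (g): `C` of CM type
  with `χ ≫ χ = -d'`, `F` with a CENTRAL `φ`, `φ ≫ φ = -(M²d')`, of UNBALANCED multiplicities, `dim_ℚ End⁰(F) ≠ 2`.
* §2 **`isCodimTwoDivisorPullbackGenerated_of_dim_eq_five_of_not_isSimple`** — EVERY NON-SIMPLE FIVEFOLD outside
  case (e) (`X ∼ E × E × T`, `E` a CM elliptic curve, `T` a simple threefold, `End⁰(E) ↪ End⁰(T)` — Thm. 0.2 (1), not a
  theorem of the tree) and outside the residual of case (g) satisfies `B² ⊆ D² + Σ_α α^* B²(X')` — UNCONDITIONALLY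
  (no simple fourfold factor: outside (e)/(f) Thm. 0.2 (4), `B = D`; (f): the Literature row; a simple fourfold
  factor: §1).
* §3 `isCodimTwoDivisorPullbackGenerated_of_isSimple_of_isOfCMType` — a SIMPLE fivefold OF CM TYPE has `B = D`
  (Pohlmann 1968 for primitive CM types of prime dimension, the tree's
  `Pohlmann1968.isDivisorGenerated_powSucc_of_isSimple_of_isOfCMType_of_prime`), hence the predicate.
* §4 THE LOCALISATION: **`moonenZarhin1999_codimTwoHodgeClasses_abelianFivefold_iff_residual`** — the named fact ↔ its
  instances at (α) the SIMPLE fivefolds NOT of CM type [Tankeev–Ribet, the tree's named fact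
  `TankeevRibet1983_hodgeClasses_divisorial_powers_simplePrimeDimension`], (β) case (e), (γ) the residual of case (g);
  and, GRANTED the Tankeev–Ribet fact (hypothesis), ↔ (β) ∧ (γ): `…_iff_residual_of_tankeevRibet`. On path: the fact
  gives each instance.

WHAT IS NOT CLAIMED: the fact is NOT discharged; case (e) (Thm. 0.2 (1)), case (g) with `End⁰(X₂) ⊋ k` (Thm. 0.2 (3))
and Tankeev–Ribet remain; nothing on `B² ≠ D²`; no Hodge-conjecture statement is made here (see the Literature file's
`IsCodimTwoDivisorPullbackGenerated.hodgeConjectureFor_of_fourfolds` and `Ring2/LowDimensionHodgeOfMarkman*`).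

## References
* [MoonenZarhin1999LowDim] B. Moonen, Yu. Zarhin, Math. Ann. 315 (1999) 711–733, Thm. 0.2 (1)–(4) with (2.8), §5 (5.1),
  (5.6)–(5.12).
* [MumfordAV1970] D. Mumford, *Abelian Varieties* (1970), §19 Thm. 1, Cor. 1–2 (pp. 173–174) and Remark p. 169.
* [Pohlmann1968] H. Pohlmann, Ann. of Math. 88 (1968), Thm. 1 (simple CM abelian varieties of prime dimension).
* [Ribet1983] K. A. Ribet, Amer. J. Math. 105 (1983) (with Tankeev: simple abelian varieties of prime dimension).
* [Milne1999] J. S. Milne, Compositio Math. 117 (1999), §2 p. 54.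
* [vanGeemen1994HodgeAV] B. van Geemen, LNM 1594 (1994), Lemma 3.7.
-/

noncomputable section

open CategoryTheory CategoryTheory.Limits

namespace Summit.HodgeConjecture.Ring2.NonSimpleFivefoldsCodimTwo

open Literature.AlgebraicGeometry.Motives (AbelianVariety)
open Literature.AlgebraicGeometry.Motives.AbelianVariety
open Literature.AlgebraicGeometry.HodgeTheory
open Literature.AlgebraicGeometry.Milne1999
open Summit.HodgeConjecture.CorCM.Domination
open Summit.HodgeConjecture.Ring2.NonSimpleFivefolds (isStablyNondegenerate_of_dim_eq_five_of_not_isSimple)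
open Summit.HodgeConjecture.Ring2.LowDimOfMarkman
  (exists_prod_isIsogenous_of_avDominatedBy exists_isIsogenous_curve_prod_of_avDominatedBy_of_dim_eq_five)

variable {X F : AbelianVariety ℂ}

/-! ### §1 Fivefolds with a simple fourfold isogeny factor -/

/-- **A fivefold with a SIMPLE FOURFOLD isogeny factor `F` satisfies `B²(X) ⊆ D²(X) + Σ_α α^* B²(X')`, outside the
residual of case (g).** `X ∼ F × C` for an elliptic curve `C` (an isogeny factor has a complement); then the
Literature row `isCodimTwoDivisorPullbackGenerated_simpleFourfold_prod_curve` (Lemma (3.4) for `End⁰(C) = ℚ`,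
Prop. (3.8) for balanced or absent central `k`, Thm. 0.2 (3) for `End⁰(F) = k`) and isogeny invariance. The hypothesis
`hres` excludes exactly: `C` of CM type (`χ ≫ χ = -d'`), `F` with a central `φ`, `φ ≫ φ = -(M²d')`, of unbalanced
multiplicities, and `dim_ℚ End⁰(F) ≠ 2`. [cite: MoonenZarhin1999LowDim, Thm. 0.2 (3)–(4), §3 Lemma (3.4), Prop. (3.8)]
[cite: MumfordAV1970, §19 Thm. 1 (pp. 173–174)] -/
theorem isCodimTwoDivisorPullbackGenerated_of_avDominatedBy_simpleFourfold (hX5 : X.dim = 5) (hFs : F.IsSimple)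
    (hF4 : F.dim = 4) (hFX : AVDominatedBy F X)
    (hres : ∀ C : AbelianVariety ℂ, C.dim = 1 → AbelianVariety.IsIsogenous X (F.prod C) →
      ∀ (χ : C ⟶ C) (d' : ℕ), 0 < d' → χ ≫ χ = -(d' • 𝟙 C) → ∀ (φ : F ⟶ F) (M : ℕ), 0 < M →
      φ ≫ φ = -((M * M * d') • 𝟙 F) → AbelianVariety.endAlgebra.of F φ ∈ Subalgebra.center ℚ F.endAlgebra →
      eigenMultiplicity F φ (Complex.I * (Real.sqrt (M * M * d' : ℕ) : ℂ)) ≠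
        eigenMultiplicity F φ (-(Complex.I * (Real.sqrt (M * M * d' : ℕ) : ℂ))) →
      Module.finrank ℚ F.endAlgebra = 2) :
    IsCodimTwoDivisorPullbackGenerated X := by
  obtain ⟨C, hdim, hFC⟩ := exists_prod_isIsogenous_of_avDominatedBy hFX
  have hC : C.dim = 1 := by omega
  exact (isCodimTwoDivisorPullbackGenerated_simpleFourfold_prod_curve hFs hF4 hC (hres C hC hFC.symm')).of_isIsogenous'
    hFC

/-! ### §2 Every non-simple fivefold outside case (e) and the residual of case (g) -/

/-- **MOONEN–ZARHIN Thm. 0.2 IN CODIMENSION 2 FOR EVERY NON-SIMPLE COMPLEX ABELIAN FIVEFOLD OUTSIDE CASE (e) AND THE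
RESIDUAL OF CASE (g) — UNCONDITIONAL: `B²(X) ⊆ D²(X) + Σ_α α^* B²(X')`.** With a simple fourfold isogeny factor: §1
(hypothesis `h4res`). Without: if no CM elliptic curve `E` and simple threefold `T` with `End⁰(E) ↪ End⁰(T)` are both
isogeny factors, Thm. 0.2 (4) (the cell's unconditional `isStablyNondegenerate_of_dim_eq_five_of_not_isSimple`,
`B = D`); otherwise `X ∼ C × (E × T)` for an elliptic curve `C`: `C ≁ E` is case (f) (the Literature row
`isCodimTwoDivisorPullbackGenerated_of_isIsogenous_caseF`, «Case (f) is easy», (5.12)), `C ∼ E` is case (e), excluded by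
`hne`. [cite: MoonenZarhin1999LowDim, Thm. 0.2 (2), (3), (4) with cases (e), (f), (g) and §5 (5.6)–(5.12)]
[cite: MumfordAV1970, §19 Thm. 1 and Cor. 1–2 (pp. 173–174)] -/
theorem isCodimTwoDivisorPullbackGenerated_of_dim_eq_five_of_not_isSimple (hX5 : X.dim = 5) (hX : ¬ X.IsSimple)
    (h4res : ∀ F C : AbelianVariety ℂ, F.IsSimple → F.dim = 4 → C.dim = 1 →
      AbelianVariety.IsIsogenous X (F.prod C) →
      ∀ (χ : C ⟶ C) (d' : ℕ), 0 < d' → χ ≫ χ = -(d' • 𝟙 C) → ∀ (φ : F ⟶ F) (M : ℕ), 0 < M →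
      φ ≫ φ = -((M * M * d') • 𝟙 F) → AbelianVariety.endAlgebra.of F φ ∈ Subalgebra.center ℚ F.endAlgebra →
      eigenMultiplicity F φ (Complex.I * (Real.sqrt (M * M * d' : ℕ) : ℂ)) ≠
        eigenMultiplicity F φ (-(Complex.I * (Real.sqrt (M * M * d' : ℕ) : ℂ))) →
      Module.finrank ℚ F.endAlgebra = 2)
    (hne : ¬ ∃ E T : AbelianVariety ℂ, E.dim = 1 ∧ IsOfCMType E ∧ T.IsSimple ∧ T.dim = 3 ∧
      Nonempty (E.endAlgebra →+* T.endAlgebra) ∧ AbelianVariety.IsIsogenous X (E.prod (E.prod T))) :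
    IsCodimTwoDivisorPullbackGenerated X := by
  by_cases h4 : ∃ F : AbelianVariety ℂ, F.IsSimple ∧ F.dim = 4 ∧ AVDominatedBy F X
  · obtain ⟨F, hFs, hF4, hFX⟩ := h4
    exact isCodimTwoDivisorPullbackGenerated_of_avDominatedBy_simpleFourfold hX5 hFs hF4 hFX
      (fun C hC hXC => h4res F C hFs hF4 hC hXC)
  have h4' : ∀ F : AbelianVariety ℂ, F.IsSimple → F.dim = 4 → ¬ AVDominatedBy F X :=
    fun F hFs hF4 hFX => h4 ⟨F, hFs, hF4, hFX⟩
  by_cases hna : ∃ E T : AbelianVariety ℂ, E.dim = 1 ∧ IsOfCMType E ∧ T.IsSimple ∧ T.dim = 3 ∧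
      AVDominatedBy E X ∧ AVDominatedBy T X ∧ Nonempty (E.endAlgebra →+* T.endAlgebra)
  · obtain ⟨E, T, hE, hEcm, hTs, hT3, hEX, hTX, ⟨j⟩⟩ := hna
    obtain ⟨C, hC, hXC⟩ := exists_isIsogenous_curve_prod_of_avDominatedBy_of_dim_eq_five hX5 hE hTs hT3 hEX hTX
    by_cases hCE : AbelianVariety.IsIsogenous C E
    · -- case (e): excluded
      exact absurd ⟨E, T, hE, hEcm, hTs, hT3, ⟨j⟩, hXC.trans (hCE.prod (AbelianVariety.IsIsogenous.refl _))⟩ hne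
    · -- case (f)
      exact isCodimTwoDivisorPullbackGenerated_of_isIsogenous_caseF hXC hC hE hEcm hCE hTs hT3 ⟨j⟩
  · exact (isStablyNondegenerate_of_dim_eq_five_of_not_isSimple hX5 hX h4' hna).isCodimTwoDivisorPullbackGenerated

/-! ### §3 Simple fivefolds of CM type -/

/-- **A SIMPLE complex abelian FIVEFOLD OF CM TYPE has `B = D`** (prime dimension: Pohlmann 1968, the tree's theorem
`Pohlmann1968.isDivisorGenerated_powSucc_of_isSimple_of_isOfCMType_of_prime` — the CM clause of Tankeev–Ribet, PROVED),
hence `B² ⊆ D² + Σ_α α^* B²(X')`. [cite: Pohlmann1968, Thm. 1] [cite: MoonenZarhin1999LowDim, §2 Thm. (2.7)] -/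
theorem isCodimTwoDivisorPullbackGenerated_of_isSimple_of_isOfCMType (hX5 : X.dim = 5) (hs : X.IsSimple)
    (hcm : IsOfCMType X) : IsCodimTwoDivisorPullbackGenerated X :=
  (Literature.AlgebraicGeometry.Pohlmann1968.isDivisorGenerated_powSucc_of_isSimple_of_isOfCMType_of_prime X
    (by norm_num : (5 : ℕ).Prime) hX5 hs hcm 0).isCodimTwoDivisorPullbackGenerated

/-! ### §4 The named fact localised -/

/-- **LOCALISATION OF THE NAMED FACT.** `MoonenZarhin1999_codimTwoHodgeClasses_abelianFivefold` (Thm. 0.2 in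
codimension `2` for ALL fivefolds) is EQUIVALENT to its instances at (α) the SIMPLE fivefolds NOT of CM type
[Tankeev–Ribet], (β) the fivefolds of case (e) [Thm. 0.2 (1)], (γ) the fivefolds `X ∼ F × C` of the residual of case
(g) [`F` a simple fourfold, `C` a CM elliptic curve `χ ≫ χ = -d'`, a central `φ` on `F` with `φ ≫ φ = -(M²d')` of
unbalanced multiplicities, `dim_ℚ End⁰(F) ≠ 2` — Thm. 0.2 (3) with `End⁰(X₂) ⊋ k`]: everything else is a theorem (§§1–3).
[cite: MoonenZarhin1999LowDim, Thm. 0.2 (1)–(4) and §5 (5.1)] [cite: Pohlmann1968, Thm. 1] -/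
theorem moonenZarhin1999_codimTwoHodgeClasses_abelianFivefold_iff_residual :
    MoonenZarhin1999_codimTwoHodgeClasses_abelianFivefold ↔
      (∀ A : AbelianVariety ℂ, A.dim = 5 → A.IsSimple → ¬ IsOfCMType A → IsCodimTwoDivisorPullbackGenerated A) ∧
      (∀ A : AbelianVariety ℂ, A.dim = 5 →
        (∃ E T : AbelianVariety ℂ, E.dim = 1 ∧ IsOfCMType E ∧ T.IsSimple ∧ T.dim = 3 ∧
          Nonempty (E.endAlgebra →+* T.endAlgebra) ∧ AbelianVariety.IsIsogenous A (E.prod (E.prod T))) →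
        IsCodimTwoDivisorPullbackGenerated A) ∧
      (∀ A : AbelianVariety ℂ, A.dim = 5 →
        (∃ (F C : AbelianVariety ℂ), F.IsSimple ∧ F.dim = 4 ∧ C.dim = 1 ∧ AbelianVariety.IsIsogenous A (F.prod C) ∧
          ∃ (χ : C ⟶ C) (d' : ℕ), 0 < d' ∧ χ ≫ χ = -(d' • 𝟙 C) ∧ ∃ (φ : F ⟶ F) (M : ℕ), 0 < M ∧
          φ ≫ φ = -((M * M * d') • 𝟙 F) ∧ AbelianVariety.endAlgebra.of F φ ∈ Subalgebra.center ℚ F.endAlgebra ∧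
          eigenMultiplicity F φ (Complex.I * (Real.sqrt (M * M * d' : ℕ) : ℂ)) ≠
            eigenMultiplicity F φ (-(Complex.I * (Real.sqrt (M * M * d' : ℕ) : ℂ))) ∧
          Module.finrank ℚ F.endAlgebra ≠ 2) →
        IsCodimTwoDivisorPullbackGenerated A) := by
  refine ⟨fun h => ⟨fun A hA _ _ => h A hA, fun A hA _ => h A hA, fun A hA _ => h A hA⟩, fun ⟨hS, hE, hG⟩ A hA => ?_⟩
  by_cases hs : A.IsSimple
  · by_cases hcm : IsOfCMType A
    · exact isCodimTwoDivisorPullbackGenerated_of_isSimple_of_isOfCMType hA hs hcm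
    · exact hS A hA hs hcm
  by_cases hcaseE : ∃ E T : AbelianVariety ℂ, E.dim = 1 ∧ IsOfCMType E ∧ T.IsSimple ∧ T.dim = 3 ∧
      Nonempty (E.endAlgebra →+* T.endAlgebra) ∧ AbelianVariety.IsIsogenous A (E.prod (E.prod T))
  · exact hE A hA hcaseE
  by_cases hcaseG : ∃ (F C : AbelianVariety ℂ), F.IsSimple ∧ F.dim = 4 ∧ C.dim = 1 ∧
      AbelianVariety.IsIsogenous A (F.prod C) ∧
      ∃ (χ : C ⟶ C) (d' : ℕ), 0 < d' ∧ χ ≫ χ = -(d' • 𝟙 C) ∧ ∃ (φ : F ⟶ F) (M : ℕ), 0 < M ∧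
      φ ≫ φ = -((M * M * d') • 𝟙 F) ∧ AbelianVariety.endAlgebra.of F φ ∈ Subalgebra.center ℚ F.endAlgebra ∧
      eigenMultiplicity F φ (Complex.I * (Real.sqrt (M * M * d' : ℕ) : ℂ)) ≠
        eigenMultiplicity F φ (-(Complex.I * (Real.sqrt (M * M * d' : ℕ) : ℂ))) ∧
      Module.finrank ℚ F.endAlgebra ≠ 2
  · exact hG A hA hcaseG
  refine isCodimTwoDivisorPullbackGenerated_of_dim_eq_five_of_not_isSimple hA hs ?_ hcaseE
  intro F C hFs hF4 hC hAFC χ d' hd' hχ φ M hM hφ hφZ hneq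
  by_contra h2
  exact hcaseG ⟨F, C, hFs, hF4, hC, hAFC, χ, d', hd', hχ, φ, M, hM, hφ, hφZ, hneq, h2⟩

/-- **GRANTED THE TANKEEV–RIBET FACT** (the tree's named fact
`TankeevRibet1983_hodgeClasses_divisorial_powers_simplePrimeDimension`, a HYPOTHESIS: simple fivefolds have `B = D`),
the fivefold fact is EQUIVALENT to its instances at case (e) and at the residual of case (g).
[cite: MoonenZarhin1999LowDim, Thm. 0.2 (1), (3) and §2 Thm. (2.7)] [cite: Ribet1983, Thm. 3] -/
theorem moonenZarhin1999_codimTwoHodgeClasses_abelianFivefold_iff_residual_of_tankeevRibet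
    (hTR : TankeevRibet1983_hodgeClasses_divisorial_powers_simplePrimeDimension) :
    MoonenZarhin1999_codimTwoHodgeClasses_abelianFivefold ↔
      (∀ A : AbelianVariety ℂ, A.dim = 5 →
        (∃ E T : AbelianVariety ℂ, E.dim = 1 ∧ IsOfCMType E ∧ T.IsSimple ∧ T.dim = 3 ∧
          Nonempty (E.endAlgebra →+* T.endAlgebra) ∧ AbelianVariety.IsIsogenous A (E.prod (E.prod T))) →
        IsCodimTwoDivisorPullbackGenerated A) ∧
      (∀ A : AbelianVariety ℂ, A.dim = 5 →
        (∃ (F C : AbelianVariety ℂ), F.IsSimple ∧ F.dim = 4 ∧ C.dim = 1 ∧ AbelianVariety.IsIsogenous A (F.prod C) ∧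
          ∃ (χ : C ⟶ C) (d' : ℕ), 0 < d' ∧ χ ≫ χ = -(d' • 𝟙 C) ∧ ∃ (φ : F ⟶ F) (M : ℕ), 0 < M ∧
          φ ≫ φ = -((M * M * d') • 𝟙 F) ∧ AbelianVariety.endAlgebra.of F φ ∈ Subalgebra.center ℚ F.endAlgebra ∧
          eigenMultiplicity F φ (Complex.I * (Real.sqrt (M * M * d' : ℕ) : ℂ)) ≠
            eigenMultiplicity F φ (-(Complex.I * (Real.sqrt (M * M * d' : ℕ) : ℂ))) ∧
          Module.finrank ℚ F.endAlgebra ≠ 2) →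
        IsCodimTwoDivisorPullbackGenerated A) := by
  rw [moonenZarhin1999_codimTwoHodgeClasses_abelianFivefold_iff_residual]
  refine ⟨fun h => ⟨h.2.1, h.2.2⟩, fun h => ⟨fun A hA hs _ => ?_, h.1, h.2⟩⟩
  exact (isDivisorGenerated_powSucc_of_tankeevRibet hTR A (by norm_num : (5 : ℕ).Prime) hA hs 0)
    |>.isCodimTwoDivisorPullbackGenerated

/-! ### §5 On path -/

/-- **On path**: the named fact, granted, gives every instance proved above (the instances are CASES of the fact; no
new target is introduced). [cite: MoonenZarhin1999LowDim, Thm. 0.2] -/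
theorem isCodimTwoDivisorPullbackGenerated_of_fact (h : MoonenZarhin1999_codimTwoHodgeClasses_abelianFivefold)
    (hX5 : X.dim = 5) : IsCodimTwoDivisorPullbackGenerated X :=
  isCodimTwoDivisorPullbackGenerated_of_dim_eq_five_of_fact h hX5

end Summit.HodgeConjecture.Ring2.NonSimpleFivefoldsCodimTwo

end
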